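import Summits.QuantumFields.BalabanUV.T4Continuum.Support.CovariantMeanContraction

/-!
# `T4Continuum.CovariantMeanRecursion` (cell-tree module `Summits/QuantumFields/BalabanUV/T4Continuum/Support/CovariantMeanRecursion.lean`)
# — road P4 of the spine estimate NE1′, TANGENT-MAP FORMULATION (v2): «ONE Schwarz gain per born term» turned into a
# per-level geometric decay by a two-line recursion; the disc form of the Schwarz gain
# (cell `pub-balaban`, scoping sub-cell `t4`, ROUND-2 prover seat #4 of BINDER-OWNERS row NE1′, unit `b2b-balaban-t4-ne1p-p4`,
# generation 2; companion of the HOME record `t4/b2b-balaban-t4-ne1p-p4/PROPAGATION-v2.md` §4.3–§4.4 and of the typed skeleton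
# `t4/skeletons/NE1p-t4-ne1p-p4.md` v2.0 leaves L8-DL (analytic core) and L8-REC; ADDITIVE — a new leaf importing
# its sibling `Support.CovariantMeanContraction` (p207492) only; nothing modified)

HONEST FRAMING.  Finite four-torus, rung (B)+1 only: the `ε → 0` limit of the joint expectations of unit-scale averaged
gauge-invariant Wilson-loop variables on ONE torus of fixed physical size.  NOT infinite volume, NOT a mass gap, NOT the Clay
problem, NOT summit progress.  HONEST DEPENDENCY: continuum YM on T⁴ ⇐ BetaPertH ∧ nine spine estimates (0/9 proved);
BetaPertH ⇐ (D1) ∧ (D4) ∧ CAP+tail; G-an2-4 gates asym, D1 and NE2/3/4.  This module is PURE REAL ARITHMETIC and ONE use of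
Mathlib's Schwarz lemma; it asserts nothing about T. Bałaban's densities; every declaration is [folklore] and sorry-free.

CITATION HEADER (lean-in-tree rule).  No page of the series (CMP 1983–89) or of any other source is quoted or attributed here.
Where the road USES these lemmas (the record `PROPAGATION-v2.md`): the propagated first-order functional of the road, after
`j` levels, is the sum of the birth functional and of the one-step corrections born at every intermediate level `i < j`
(each of relative size `ε`), every summand being evaluated at depth with its OWN Schwarz factor `C·r^{j−i}` (`r ≈ L⁻²`, the
nesting of the multi-scale regularity spaces; `C` the geometry constant of the disc) — this is the recursion hypothesis of
`le_geometric_of_recursion`; its conclusion is the per-level rate `r(1+η)` with the constant `2C` paid ONCE.  The disc lemma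
`norm_le_div_of_disc` is the Schwarz lemma along an analytic disc `ψ : ℂ → E` through a zero of the functional, the form in
which the road applies the gain (the gauge disc `λ ↦ (exp iλξA)^g` through the nearest pure gauge).  Generation 1's
`CovariantMeanContraction.norm_le_div_mul_norm_of_vanishing` (p207492) is the ball form it is derived from.
-/

noncomputable section

open Finset Metric Set

namespace Summit.QuantumFields.BalabanUV.T4Continuum.CovariantMeanRecursion

/-! ## §1 The recursion: one Schwarz factor per born term ⟹ geometric decay per level -/

section Recursion

/-- The finite geometric sum against the larger ratio: for `0 < η`,
`∑_{i<j} (1+η)^i = ((1+η)^j − 1)/η ≤ (1+η)^j/η`. [folklore] -/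
theorem geom_sum_one_add_le {η : ℝ} (hη : 0 < η) (j : ℕ) :
    ∑ i ∈ range j, (1 + η) ^ i ≤ (1 + η) ^ j / η := by
  have hne : (1 + η : ℝ) ≠ 1 := by linarith
  rw [geom_sum_eq hne j]
  have hden : (1 + η : ℝ) - 1 = η := by ring
  rw [hden]
  exact div_le_div_of_nonneg_right (by linarith) hη.le

/-- Re-indexing the convolution sum of the recursion against a geometric majorant: if `x i ≤ A·ρ^i` for `i < j` with
`ρ = r(1+η)`, then `∑_{i<j} r^{j-1-i}·x i ≤ A·r^{j-1}·(1+η)^j/η` (`j ≥ 1`). [folklore] -/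
theorem conv_sum_le {x : ℕ → ℝ} {A r η : ℝ} (hA : 0 ≤ A) (hr : 0 < r) (hη : 0 < η) {j : ℕ} (hj : 1 ≤ j)
    (hx : ∀ i, i < j → x i ≤ A * (r * (1 + η)) ^ i) :
    ∑ i ∈ range j, r ^ (j - 1 - i) * x i ≤ A * r ^ (j - 1) * ((1 + η) ^ j / η) := by
  have hρ : 0 ≤ r * (1 + η) := by positivity
  have hstep : ∀ i ∈ range j, r ^ (j - 1 - i) * x i ≤ A * r ^ (j - 1) * (1 + η) ^ i := by
    intro i hi
    have hij : i < j := mem_range.mp hi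
    have hile : i ≤ j - 1 := by omega
    calc r ^ (j - 1 - i) * x i ≤ r ^ (j - 1 - i) * (A * (r * (1 + η)) ^ i) :=
          mul_le_mul_of_nonneg_left (hx i hij) (pow_nonneg hr.le _)
      _ = A * (r ^ i * r ^ (j - 1 - i)) * (1 + η) ^ i := by rw [mul_pow]; ring
      _ = A * r ^ (j - 1) * (1 + η) ^ i := by rw [pow_mul_pow_sub r hile]
  calc ∑ i ∈ range j, r ^ (j - 1 - i) * x i ≤ ∑ i ∈ range j, A * r ^ (j - 1) * (1 + η) ^ i := sum_le_sum hstep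
    _ = A * r ^ (j - 1) * ∑ i ∈ range j, (1 + η) ^ i := by rw [mul_sum]
    _ ≤ A * r ^ (j - 1) * ((1 + η) ^ j / η) :=
        mul_le_mul_of_nonneg_left (geom_sum_one_add_le hη j) (by positivity)

/-- **THE RECURSION LEMMA** (record `PROPAGATION-v2.md` §4.4, skeleton leaf L8-REC).  Let `x : ℕ → ℝ` with `0 ≤ x 0` satisfy,
for every `j ≥ 1`, `x j ≤ C·r^j·x 0 + C·ε·∑_{i<j} r^{j-1-i}·x i` (the birth term with its Schwarz factor from level `0`, plus the
corrections born at the levels `i < j`, each of relative size `ε` and each with its own Schwarz factor from level `i+1`), where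
`C ≥ 1`, `r > 0`, `η > 0` and `0 ≤ ε ≤ rη/(2C)`.  Then `x j ≤ 2C·(r(1+η))^j·x 0` for every `j`: geometric decay at the rate
`r(1+η)` with the constant `2C` paid once — no blocks of steps are needed. [folklore] -/
theorem le_geometric_of_recursion {x : ℕ → ℝ} {C r η ε : ℝ} (hC : 1 ≤ C) (hr : 0 < r) (hη : 0 < η) (hε0 : 0 ≤ ε)
    (hε : ε ≤ r * η / (2 * C)) (hx0 : 0 ≤ x 0)
    (hrec : ∀ j, 1 ≤ j → x j ≤ C * r ^ j * x 0 + C * ε * ∑ i ∈ range j, r ^ (j - 1 - i) * x i) :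
    ∀ j, x j ≤ 2 * C * (r * (1 + η)) ^ j * x 0 := by
  have hC0 : 0 < C := lt_of_lt_of_le zero_lt_one hC
  have hρ0 : 0 ≤ r * (1 + η) := by positivity
  have hrρ : ∀ j : ℕ, r ^ j ≤ (r * (1 + η)) ^ j := fun j =>
    pow_le_pow_left₀ hr.le (by nlinarith) j
  intro j
  induction j using Nat.strong_induction_on with
  | _ j ih =>
    rcases Nat.eq_zero_or_pos j with hj | hj
    · subst hj
      simp only [pow_zero, mul_one]
      nlinarith
    · have hj1 : 1 ≤ j := hj
      have hA : 0 ≤ 2 * C * x 0 := by positivity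
      have hconv := conv_sum_le (x := x) hA hr hη hj1 (fun i hi => by
        have := ih i hi
        linarith [this])
      -- `2Cε/η ≤ r`
      have hkey : C * ε * (2 * C * x 0 * r ^ (j - 1) * ((1 + η) ^ j / η)) ≤ C * x 0 * (r * (1 + η)) ^ j := by
        have h2 : 2 * C * ε ≤ r * η := by
          have := (le_div_iff₀ (by positivity : (0:ℝ) < 2 * C)).mp hε
          linarith
        have hpow : r ^ (j - 1) * r = r ^ j := by
          rw [← pow_succ]; congr 1; omega
        have hηj : 0 ≤ (1 + η) ^ j := pow_nonneg (by linarith) j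
        have hrj : 0 ≤ r ^ (j - 1) := pow_nonneg hr.le _
        have hηne : η ≠ 0 := hη.ne'
        have e1 : C * ε * (2 * C * x 0 * r ^ (j - 1) * ((1 + η) ^ j / η))
            = C * x 0 * r ^ (j - 1) * (1 + η) ^ j * ((2 * C * ε) / η) := by
          field_simp
        have e2 : C * x 0 * r ^ (j - 1) * (1 + η) ^ j * ((r * η) / η) = C * x 0 * (r * (1 + η)) ^ j := by
          rw [mul_div_assoc, div_self hηne, mul_one, mul_pow, ← hpow]; ring
        rw [e1, ← e2]
        apply mul_le_mul_of_nonneg_left _ (by positivity)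
        exact div_le_div_of_nonneg_right h2 hη.le
      calc x j ≤ C * r ^ j * x 0 + C * ε * ∑ i ∈ range j, r ^ (j - 1 - i) * x i := hrec j hj1
        _ ≤ C * r ^ j * x 0 + C * ε * (2 * C * x 0 * r ^ (j - 1) * ((1 + η) ^ j / η)) := by
            have hCε : 0 ≤ C * ε := by positivity
            have := mul_le_mul_of_nonneg_left hconv hCε
            linarith
        _ ≤ C * (r * (1 + η)) ^ j * x 0 + C * x 0 * (r * (1 + η)) ^ j := by
            have := mul_le_mul_of_nonneg_left (hrρ j) (by positivity : 0 ≤ C * x 0)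
            nlinarith [hkey, this]
        _ = 2 * C * (r * (1 + η)) ^ j * x 0 := by ring

/-- The bound sequence instantiating the ladder slot `StepSupply.contract` of `CovariantMeanSupply` (p207717): with
`N j := A·ρ^j` the one-step relation `N (j+1) ≤ ρ·N j` holds with equality — the road's actual sup norms need not contract step
by step; only their geometric majorant is fed to the slot. [folklore] -/
theorem ladder_of_geometric (A ρ : ℝ) (j : ℕ) : A * ρ ^ (j + 1) ≤ ρ * (A * ρ ^ j) := by
  rw [pow_succ]; ring_nf; exact le_rfl

/-- Numeric side condition of the road in Bałaban's numbers (record §4.4): with `r = (1+β₀)L⁻²` and the pushforward factor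
`θ₁ = L⁻³` per level, the first-order channel's per-level ratio against the count `Λ₄ = L⁴` is `L⁴·L⁻³·((1+β₀)(1+η)L⁻²) =
(1+β₀)(1+η)L⁻¹`, which is `< 1` as soon as `(1+β₀)(1+η) < L`. [folklore] -/
theorem firstOrder_ratio_lt_one {L β₀ η : ℝ} (hL : 0 < L) (h : (1 + β₀) * (1 + η) < L) :
    L ^ 4 * L⁻¹ ^ 3 * ((1 + β₀) * (1 + η) * L⁻¹ ^ 2) < 1 := by
  have hL0 : L ≠ 0 := hL.ne'
  have : L ^ 4 * L⁻¹ ^ 3 * ((1 + β₀) * (1 + η) * L⁻¹ ^ 2) = (1 + β₀) * (1 + η) / L := by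
    field_simp
  rw [this, div_lt_one hL]
  exact h

end Recursion

/-! ## §2 The disc form of the Schwarz gain (analytic core of the depth lemma L8-DL) -/

section Disc

variable {E F : Type*} [NormedAddCommGroup E] [NormedSpace ℂ E] [NormedAddCommGroup F] [NormedSpace ℂ F]

/-- Schwarz along a disc in `ℂ`: if `φ : ℂ → F` is differentiable on the ball of radius `Λ > 1` about `0`, bounded by `N` there,
and `φ 0 = 0`, then `‖φ 1‖ ≤ N/Λ`. [folklore] -/
theorem norm_apply_one_le_of_disc {φ : ℂ → F} {Λ N : ℝ} (hΛ : 1 < Λ) (hφ : DifferentiableOn ℂ φ (ball 0 Λ))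
    (hN : ∀ w ∈ ball (0 : ℂ) Λ, ‖φ w‖ ≤ N) (h0 : φ 0 = 0) : ‖φ 1‖ ≤ N / Λ := by
  have h1 : (1 : ℂ) ∈ ball (0 : ℂ) Λ := by
    rw [mem_ball, dist_zero_right, norm_one]; exact hΛ
  have h := CovariantMeanContraction.norm_le_div_mul_norm_of_vanishing hφ hN h0 h1
  simpa using h

/-- **THE DISC LEMMA** (record §4.3, analytic core): let `Φ : E → F` be differentiable on an open set `S` and bounded by `N`
there, and let `ψ : ℂ → E` be differentiable with `ψ w ∈ S` for `‖w‖ < Λ` (`Λ > 1`) and `Φ (ψ 0) = 0` (the disc passes through a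
zero of `Φ` — on the road: the nearest pure-gauge configuration, where every covariant local functional vanishes).  Then
`‖Φ (ψ 1)‖ ≤ N/Λ`.  On the road `Λ ≍ L^{2s}` is the depth of a scale-`(m+s)`-regular configuration inside the scale-`m` space,
and `1/Λ` is the covariant-mean gain. [folklore] -/
theorem norm_le_div_of_disc {Φ : E → F} {S : Set E} {ψ : ℂ → E} {Λ N : ℝ} (hΛ : 1 < Λ) (hS : IsOpen S)
    (hΦ : DifferentiableOn ℂ Φ S) (hN : ∀ V ∈ S, ‖Φ V‖ ≤ N) (hψ : Differentiable ℂ ψ)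
    (hmaps : MapsTo ψ (ball 0 Λ) S) (h0 : Φ (ψ 0) = 0) : ‖Φ (ψ 1)‖ ≤ N / Λ := by
  have _ := hS
  have hcomp : DifferentiableOn ℂ (Φ ∘ ψ) (ball 0 Λ) :=
    hΦ.comp hψ.differentiableOn hmaps
  have hNc : ∀ w ∈ ball (0 : ℂ) Λ, ‖(Φ ∘ ψ) w‖ ≤ N := fun w hw => hN _ (hmaps hw)
  have h0c : (Φ ∘ ψ) 0 = 0 := h0
  exact norm_apply_one_le_of_disc hΛ hcomp hNc h0c

/-- The affine disc: `ψ w = V₀ + w • A` through `V₀` in the direction `A`; if the ball of radius `R` about `V₀` lies in `S` and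
`‖A‖ ≤ R/Λ`, the disc of radius `Λ` maps into `S`, so `‖Φ (V₀ + A)‖ ≤ N/Λ` — depth `‖A‖/R ≤ 1/Λ` converts into the gain
`1/Λ`. [folklore] -/
theorem norm_le_div_of_affine_disc {Φ : E → F} {S : Set E} {V₀ A : E} {Λ N R : ℝ} (hΛ : 1 < Λ) (hS : IsOpen S)
    (hΦ : DifferentiableOn ℂ Φ S) (hN : ∀ V ∈ S, ‖Φ V‖ ≤ N) (hball : ball V₀ R ⊆ S)
    (hA : ‖A‖ * Λ ≤ R) (hA0 : A ≠ 0) (h0 : Φ V₀ = 0) : ‖Φ (V₀ + A)‖ ≤ N / Λ := by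
  set ψ : ℂ → E := fun w => V₀ + w • A with hψ_def
  have hψ : Differentiable ℂ ψ := by
    intro w
    simp only [hψ_def]
    fun_prop
  have hmaps : MapsTo ψ (ball 0 Λ) S := by
    intro w hw
    apply hball
    rw [mem_ball, dist_eq_norm]
    simp only [hψ_def, add_sub_cancel_left, norm_smul]
    rw [mem_ball, dist_zero_right] at hw
    have hApos : 0 < ‖A‖ := norm_pos_iff.mpr hA0
    calc ‖w‖ * ‖A‖ < Λ * ‖A‖ := mul_lt_mul_of_pos_right hw hApos
      _ = ‖A‖ * Λ := mul_comm _ _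
      _ ≤ R := hA
  have h0' : Φ (ψ 0) = 0 := by simp only [hψ_def, zero_smul, add_zero]; exact h0
  have h := norm_le_div_of_disc hΛ hS hΦ hN hψ hmaps h0'
  simpa [hψ_def] using h

end Disc

end Summit.QuantumFields.BalabanUV.T4Continuum.CovariantMeanRecursion
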